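import Summits.AtomisticToContinuum.Crystallization.Theorems.GappedShellCensusCleanLimitsHaveWindowsInplaneGain4

/-!
# `CleanLimitsHaveWindows` (stmt-AtomisticToContinuum-15932), line `Sketch`, stub `stub_inplaneGain`, helper 5:
# per-site and per-layer bounds for the in-plane expansion (lower sliver, `λ = 201/200`)

Support file for the certified in-plane gain. For the expansion `a ↦ λa`, `Λ = λ² = 40401/40000`, of a layered
set with spacing `a² ∈ [A₁, A₂]` at preserved nearest interlayer bonds (so the heights shrink:
`H'² ≤ H²`), every site term `E(a²P + H²) - E(Λa²P + H'²)` is bounded below by an explicit rational function of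
`P` (one-sided Taylor bound of helper 1): in-plane `igNNind(P)(E(a²) - E(Λa²)) + igRingL A₁ A₂ P`
(`ig_site_ringL`), adjacent layers `igAdjL A₁ A₂ P` (`ig_site_adjL`), far layers
`igFarL A₁ A₂ h₁ h₂ h₁' β P` (`ig_site_farL`, `H² ∈ [h₁, h₂]`, `H'² ∈ [h₁', H²]`, `H² - H'² ≥ β`). The layer
bounds `ig_layer_inL`, `ig_layer_adjL`, `ig_layer_farL` are box sums minus the tails of the inverse-cube majorants
`(401/40000)(A₂/(2A₁⁴)) (P + T)⁻³` of the horizontal losses; `ig_layer_genL` is the generic far-layer bound.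
-/

noncomputable section

namespace Summit.AtomisticToContinuum.Crystallization.Theorems.CleanHull

open Summit.AtomisticToContinuum.Crystallization.Theorems.LayeredHull
open Literature.MathematicalPhysics.StatisticalMechanics Finset

/-! ## Per-site bounds -/

/-- A loss bounded through the Taylor weight: if `1 ≤ q ≤ q'`, `q₁ ≤ q`, `q' ≤ q'₂`, `0 < q₁` and `q' - q ≤ d`,
then `-(d (1 - q'₂⁻³)/(2 q₁⁴)) ≤ E(q) - E(q')`. [folklore] -/
theorem ig_loss_bound {q q' q₁ q'₂ d : ℝ} (hq : 1 ≤ q) (hqq : q ≤ q') (hq₁ : 0 < q₁) (hq₁q : q₁ ≤ q)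
    (hq'₂ : q' ≤ q'₂) (hd : q' - q ≤ d) :
    -(d * (1 - (q'₂⁻¹) ^ 3) / (2 * q₁ ^ 4)) ≤ igE q - igE q' := by
  have hq' : 1 ≤ q' := hq.trans hqq
  have hT := ig_taylor hq hq'
  have hw := ig_weight_mono hq₁ hq₁q hq' hq'₂
  have hw0 : 0 ≤ (1 - (q'⁻¹) ^ 3) / (2 * q ^ 4) := div_nonneg (ig_one_sub_inv3_nonneg hq') (by positivity)
  have hd0 : 0 ≤ d := by linarith
  have h1 : -(d * (1 - (q'₂⁻¹) ^ 3) / (2 * q₁ ^ 4)) = (-d) * ((1 - (q'₂⁻¹) ^ 3) / (2 * q₁ ^ 4)) := by ring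
  rw [h1]
  calc (-d) * ((1 - (q'₂⁻¹) ^ 3) / (2 * q₁ ^ 4)) ≤ (-d) * ((1 - (q'⁻¹) ^ 3) / (2 * q ^ 4)) :=
        mul_le_mul_of_nonpos_left hw (by linarith)
    _ ≤ (q - q') * ((1 - (q'⁻¹) ^ 3) / (2 * q ^ 4)) := mul_le_mul_of_nonneg_right (by linarith) hw0
    _ = (q - q') * (1 - (q'⁻¹) ^ 3) / (2 * q ^ 4) := by ring
    _ ≤ _ := hT

/-- **In-plane sites under the expansion.** [folklore] -/
theorem ig_site_ringL {a A₁ A₂ : ℝ} (hA₁ : 1 / 2 ≤ A₁) (h1 : A₁ ≤ a ^ 2) (h2 : a ^ 2 ≤ A₂) (p : ℤ × ℤ) :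
    igNNind (igP 0 p) * (igE (a ^ 2) - igE (40401 / 40000 * a ^ 2)) + igRingL A₁ A₂ (igP 0 p) ≤
      igE (a ^ 2 * igP 0 p) - igE (40401 / 40000 * a ^ 2 * igP 0 p) := by
  rcases ig_P0_trichotomy p with h | h | h
  · rw [h]; norm_num [igNNind, igRingL, ig_E_zero]
  · rw [h]; norm_num [igNNind, igRingL]
  · set P := igP 0 p with hP
    have hnn : igNNind P = 0 := by unfold igNNind; rw [if_neg (by linarith)]
    rw [hnn, zero_mul, zero_add]
    unfold igRingL
    rw [if_neg (by linarith)]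
    have e : 401 / 40000 * A₂ * P * (1 - ((40401 / 40000 * A₂ * P)⁻¹) ^ 3) / (2 * (A₁ * P) ^ 4) =
        (401 / 40000 * A₂ * P) * (1 - ((40401 / 40000 * A₂ * P)⁻¹) ^ 3) / (2 * (A₁ * P) ^ 4) := by ring
    rw [e]
    exact ig_loss_bound (by nlinarith) (by nlinarith) (by nlinarith) (by nlinarith) (by nlinarith) (by nlinarith)

/-- **Adjacent-layer sites under the expansion** (`b = a²/3 + D²`). [folklore] -/
theorem ig_site_adjL {a b A₁ A₂ : ℝ} (hA₁ : 1 / 2 ≤ A₁) (h1 : A₁ ≤ a ^ 2) (h2 : a ^ 2 ≤ A₂) (hb1 : 81 / 100 ≤ b)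
    (hb2 : b ≤ 2601 / 2500) (p : ℤ × ℤ) :
    igAdjL A₁ A₂ (igP 1 p) ≤
      igE (a ^ 2 * (igP 1 p - 1 / 3) + b) - igE (40401 / 40000 * a ^ 2 * (igP 1 p - 1 / 3) + b) := by
  rcases ig_P1_dichotomy p with h | h
  · rw [h]; norm_num [igAdjL]
  · set x := igP 1 p - 1 / 3 with hx
    have hx1 : 1 ≤ x := by rw [hx]; linarith
    unfold igAdjL
    rw [if_neg (by linarith), ← hx]
    have e : 401 / 40000 * A₂ * x * (1 - ((40401 / 40000 * A₂ * x + 2601 / 2500)⁻¹) ^ 3) /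
        (2 * (A₁ * x + 81 / 100) ^ 4) = (401 / 40000 * A₂ * x) *
          (1 - ((40401 / 40000 * A₂ * x + 2601 / 2500)⁻¹) ^ 3) / (2 * (A₁ * x + 81 / 100) ^ 4) := by ring
    rw [e]
    exact ig_loss_bound (by nlinarith) (by nlinarith) (by nlinarith) (by nlinarith) (by nlinarith) (by nlinarith)

/-- **Far-layer sites under the expansion.** [folklore] -/
theorem ig_site_farL {a h h' A₁ A₂ h₁ h₂ h₁' β P : ℝ} (hA₁ : 0 < A₁) (h1 : A₁ ≤ a ^ 2) (h2 : a ^ 2 ≤ A₂)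
    (hh1 : h₁ ≤ h) (hh2 : h ≤ h₂) (hh'1 : h₁' ≤ h') (hh' : h' ≤ h) (hβ : β ≤ h - h') (hone : 1 ≤ h₁')
    (hh0 : h₁' ≤ h₁) (hP : 0 ≤ P) :
    igFarL A₁ A₂ h₁ h₂ h₁' β P ≤ igE (a ^ 2 * P + h) - igE (40401 / 40000 * a ^ 2 * P + h') := by
  set q := a ^ 2 * P + h with hq
  set q' := 40401 / 40000 * a ^ 2 * P + h' with hq'
  have haP : 0 ≤ a ^ 2 * P := by nlinarith
  have hq1 : 1 ≤ q := by rw [hq]; nlinarith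
  have hq'lo : 40401 / 40000 * A₁ * P + h₁' ≤ q' := by rw [hq']; nlinarith
  have hq'lo1 : 1 ≤ 40401 / 40000 * A₁ * P + h₁' := by nlinarith
  have hq'hi : q' ≤ 40401 / 40000 * A₂ * P + h₂ := by rw [hq']; nlinarith
  have hqlo : A₁ * P + h₁ ≤ q := by rw [hq]; nlinarith
  have hqlo0 : 0 < A₁ * P + h₁ := by nlinarith [mul_nonneg hA₁.le hP]
  have hqhi : q ≤ A₂ * P + h₂ := by rw [hq]; nlinarith
  have hT := ig_taylor hq1 (hq'lo1.trans hq'lo)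
  set w := (1 - (q'⁻¹) ^ 3) / (2 * q ^ 4) with hw
  have hw0 : 0 ≤ w := div_nonneg (ig_one_sub_inv3_nonneg (hq'lo1.trans hq'lo)) (by positivity)
  have hwlo : (1 - ((40401 / 40000 * A₁ * P + h₁')⁻¹) ^ 3) / (2 * (A₂ * P + h₂) ^ 4) ≤ w :=
    ig_weight_mono (by linarith) hqhi hq'lo1 hq'lo
  have hwhi : w ≤ (1 - ((40401 / 40000 * A₂ * P + h₂)⁻¹) ^ 3) / (2 * (A₁ * P + h₁) ^ 4) :=
    ig_weight_mono hqlo0 hqlo (hq'lo1.trans hq'lo) hq'hi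
  have hcoef : β - 401 / 40000 * A₂ * P ≤ q - q' := by rw [hq, hq']; nlinarith
  have hTw : (q - q') * w ≤ igE q - igE q' := by
    have e : (q - q') * w = (q - q') * (1 - (q'⁻¹) ^ 3) / (2 * q ^ 4) := by rw [hw]; ring
    rw [e]; exact hT
  set c₀ := β - 401 / 40000 * A₂ * P with hc₀
  unfold igFarL
  rw [← hc₀]
  rcases le_or_gt 0 c₀ with hc | hc
  · rw [max_eq_left hc, min_eq_right hc, zero_mul, add_zero]
    calc c₀ * ((1 - ((40401 / 40000 * A₁ * P + h₁')⁻¹) ^ 3) / (2 * (A₂ * P + h₂) ^ 4)) ≤ c₀ * w :=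
          mul_le_mul_of_nonneg_left hwlo hc
      _ ≤ (q - q') * w := mul_le_mul_of_nonneg_right hcoef hw0
      _ ≤ _ := hTw
  · rw [max_eq_right hc.le, min_eq_left hc.le, zero_mul, zero_add]
    calc c₀ * ((1 - ((40401 / 40000 * A₂ * P + h₂)⁻¹) ^ 3) / (2 * (A₁ * P + h₁) ^ 4)) ≤ c₀ * w :=
          mul_le_mul_of_nonpos_left hwhi hc.le
      _ ≤ (q - q') * w := mul_le_mul_of_nonneg_right hcoef hw0
      _ ≤ _ := hTw

/-- The horizontal-loss majorant: `c P / (2 (A₁ P + h)⁴) ≤ (c/(2 A₁⁴)) ((P + h/A₁)⁻¹)³` for `c, P, h ≥ 0`,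
`A₁ > 0`, `A₁P + h > 0`. [folklore] -/
theorem ig_loss_majorant {c A₁ P h : ℝ} (hc : 0 ≤ c) (hA₁ : 0 < A₁) (hh : 0 ≤ h) (hq : 0 < A₁ * P + h) :
    c * P / (2 * (A₁ * P + h) ^ 4) ≤ c / (2 * A₁ ^ 4) * ((P + h / A₁)⁻¹) ^ 3 := by
  have e : P + h / A₁ = (A₁ * P + h) / A₁ := by field_simp
  rw [e, inv_div, div_pow]
  rw [div_le_iff₀ (by positivity)]
  have e2 : c / (2 * A₁ ^ 4) * (A₁ ^ 3 / (A₁ * P + h) ^ 3) * (2 * (A₁ * P + h) ^ 4) = c * ((A₁ * P + h) / A₁) := by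
    field_simp
  rw [e2]
  apply mul_le_mul_of_nonneg_left _ hc
  rw [le_div_iff₀ hA₁]
  nlinarith

/-- The far-site bound is at least minus the majorant `(401/40000)(A₂/(2A₁⁴))((P + h₁/A₁)⁻¹)³`. [folklore] -/
theorem ig_farL_ge_neg {A₁ A₂ h₁ h₂ h₁' β P : ℝ} (hA₁ : 0 < A₁) (hA : A₁ ≤ A₂) (hβ : 0 ≤ β) (hone : 1 ≤ h₁')
    (hh' : h₁' ≤ h₁) (hh : h₁ ≤ h₂) (hP : 0 ≤ P) :
    -(401 / 40000 * A₂ / (2 * A₁ ^ 4) * ((P + h₁ / A₁)⁻¹) ^ 3) ≤ igFarL A₁ A₂ h₁ h₂ h₁' β P := by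
  unfold igFarL
  have hA₂ : 0 ≤ A₂ := hA₁.le.trans hA
  have hAP : 0 ≤ A₁ * P := by positivity
  have hAP2 : 0 ≤ A₂ * P := by positivity
  have hlo1 : 1 ≤ 40401 / 40000 * A₁ * P + h₁' := by nlinarith
  have hhi1 : 1 ≤ 40401 / 40000 * A₂ * P + h₂ := by nlinarith
  have hmax : 0 ≤ max (β - 401 / 40000 * A₂ * P) 0 *
      ((1 - ((40401 / 40000 * A₁ * P + h₁')⁻¹) ^ 3) / (2 * (A₂ * P + h₂) ^ 4)) := by
    have := ig_one_sub_inv3_nonneg hlo1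
    have : 0 ≤ A₂ * P + h₂ := by nlinarith
    positivity
  have hmin : -(401 / 40000 * A₂ * P) ≤ min (β - 401 / 40000 * A₂ * P) 0 := le_min (by linarith) (by nlinarith)
  set w := (1 - ((40401 / 40000 * A₂ * P + h₂)⁻¹) ^ 3) / (2 * (A₁ * P + h₁) ^ 4) with hw
  have hq0 : 0 < A₁ * P + h₁ := by nlinarith
  have hw0 : 0 ≤ w := div_nonneg (ig_one_sub_inv3_nonneg hhi1) (by positivity)
  have hw1 : w ≤ 1 / (2 * (A₁ * P + h₁) ^ 4) := by
    rw [hw]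
    apply div_le_div_of_nonneg_right _ (by positivity)
    have : 0 ≤ ((40401 / 40000 * A₂ * P + h₂)⁻¹) ^ 3 := by positivity
    linarith
  have hmaj := ig_loss_majorant (show (0 : ℝ) ≤ 401 / 40000 * A₂ by positivity) hA₁ (by linarith) hq0
  have key : -(401 / 40000 * A₂ * P * (1 / (2 * (A₁ * P + h₁) ^ 4))) ≤ min (β - 401 / 40000 * A₂ * P) 0 * w := by
    calc -(401 / 40000 * A₂ * P * (1 / (2 * (A₁ * P + h₁) ^ 4))) ≤ -(401 / 40000 * A₂ * P * w) := by
          nlinarith [mul_le_mul_of_nonneg_left hw1 (show 0 ≤ 401 / 40000 * A₂ * P by positivity)]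
      _ = (-(401 / 40000 * A₂ * P)) * w := by ring
      _ ≤ min (β - 401 / 40000 * A₂ * P) 0 * w := mul_le_mul_of_nonneg_right hmin hw0
  have e : 401 / 40000 * A₂ * P * (1 / (2 * (A₁ * P + h₁) ^ 4)) = 401 / 40000 * A₂ * P / (2 * (A₁ * P + h₁) ^ 4) := by
    ring
  rw [e] at key
  linarith

/-! ## Per-layer bounds -/

/-- `(201/200 · a)² = Λ a²`. [folklore] -/
theorem ig_lamL_sq (a : ℝ) : (201 / 200 * a) ^ 2 = 40401 / 40000 * a ^ 2 := by ring

/-- **The in-plane layer under the expansion**: nearest-neighbour gain times the number of nearest neighbours in the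
box, plus the (negative) certified ring sum, minus the tail of the ring majorant. [folklore] -/
theorem ig_layer_inL {a A₁ A₂ : ℝ} (hA₁ : 1 / 2 ≤ A₁) (h1 : A₁ ≤ a ^ 2) (h2 : a ^ 2 ≤ A₂) {N : ℕ} (hN : 1 ≤ N) :
    (igE (a ^ 2) - igE (40401 / 40000 * a ^ 2)) * ∑ p ∈ igBox N, igNNind (igP 0 p) +
        ∑ p ∈ igBox N, igRingL A₁ A₂ (igP 0 p) -
        32 * ((N : ℝ) + 1) / (2 * (6 * N + 1)) * (401 / 40000 * A₂ / (2 * A₁ ^ 4)) *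
          ((3 / 4 * ((N : ℝ) - 1 / 3) ^ 2 + 5 / 12)⁻¹) ^ 2 ≤
      inLayerInteraction lennardJones a - inLayerInteraction lennardJones (201 / 200 * a) := by
  have ha : 0 < a ^ 2 := by linarith
  have hA0 : 0 < A₁ := by linarith
  have hs1 := ig_summable_site ha le_rfl 0 (Or.inl rfl)
  have hs2 := ig_summable_site (by positivity : (0 : ℝ) < 40401 / 40000 * a ^ 2) le_rfl 0 (Or.inl rfl)
  rw [ig_inLayer_eq, ig_inLayer_eq, ig_lamL_sq]
  simp only [add_zero] at hs1 hs2
  rw [← Summable.tsum_sub hs1 hs2, mul_sum, ← sum_add_distrib]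
  have hC : (0 : ℝ) ≤ 401 / 40000 * A₂ / (2 * A₁ ^ 4) := by
    have : 0 ≤ A₂ := by linarith
    positivity
  obtain ⟨hns, hnle⟩ := ig_tail_inv_pow_zero hC (n := 2) hN (by norm_num)
  have e2 : ((2 : ℕ) : ℝ) = 2 := by norm_num
  rw [e2] at hnle
  refine ig_box_tail (hs1.sub hs2) hns (fun p _ => ?_) (fun p hp => ?_) hnle
  · have := ig_site_ringL hA₁ h1 h2 p
    linarith
  · have hle := ig_site_ringL hA₁ h1 h2 p
    have hr := ig_not_mem_igBox hp
    have hs := ig_P0_ge_shell p (by omega)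
    have hr2 : (2 : ℝ) ≤ ((max |p.1| |p.2| : ℤ) : ℝ) := by exact_mod_cast (show (2 : ℤ) ≤ _ by omega)
    have hP3 : 5 / 2 ≤ igP 0 p := by nlinarith
    have hnn : igNNind (igP 0 p) = 0 := by unfold igNNind; rw [if_neg (by linarith)]
    rw [hnn, zero_mul, zero_add] at hle
    refine le_trans ?_ hle
    unfold igRingL
    rw [if_neg (by linarith), neg_le_neg_iff]
    set P := igP 0 p
    have hA₂ : 0 ≤ A₂ := by linarith
    have hP0 : 0 ≤ P := by linarith
    have hsub1 : 1 - ((40401 / 40000 * A₂ * P)⁻¹) ^ 3 ≤ 1 := by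
      have : 0 ≤ ((40401 / 40000 * A₂ * P)⁻¹) ^ 3 := by positivity
      linarith
    have hsub0 := ig_one_sub_inv3_nonneg (show 1 ≤ 40401 / 40000 * A₂ * P by nlinarith)
    have hmaj := ig_loss_majorant (show (0 : ℝ) ≤ 401 / 40000 * A₂ by positivity) hA0
      le_rfl (by nlinarith : 0 < A₁ * P + 0)
    simp only [add_zero, zero_div] at hmaj
    calc 401 / 40000 * A₂ * P * (1 - ((40401 / 40000 * A₂ * P)⁻¹) ^ 3) / (2 * (A₁ * P) ^ 4)
        ≤ 401 / 40000 * A₂ * P * 1 / (2 * (A₁ * P) ^ 4) := by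
          apply div_le_div_of_nonneg_right _ (by positivity)
          exact mul_le_mul_of_nonneg_left hsub1 (by positivity)
      _ = 401 / 40000 * A₂ * P / (2 * (A₁ * P) ^ 4) := by ring
      _ ≤ 401 / 40000 * A₂ / (2 * A₁ ^ 4) * (P⁻¹) ^ 3 := hmaj

/-- **An adjacent layer under the expansion** (`D'² = D² + a²(1 - Λ)/3`). [folklore] -/
theorem ig_layer_adjL {a D D' A₁ A₂ : ℝ} (hA₁ : 1 / 2 ≤ A₁) (hA₁2 : A₁ ≤ 2) (h1 : A₁ ≤ a ^ 2) (h2 : a ^ 2 ≤ A₂)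
    (hD' : D' ^ 2 = D ^ 2 + a ^ 2 * (1 - (201 / 200 : ℝ) ^ 2) / 3) (hb1 : 81 / 100 ≤ a ^ 2 / 3 + D ^ 2)
    (hb2 : a ^ 2 / 3 + D ^ 2 ≤ 2601 / 2500) {N : ℕ} (hN : 1 ≤ N) :
    ∑ p ∈ igBox N, igAdjL A₁ A₂ (igP 1 p) -
        32 * ((N : ℝ) + 1) / (2 * (6 * N + 1)) * (401 / 40000 * A₂ / (2 * A₁ ^ 4)) *
          ((3 / 4 * ((N : ℝ) - 1 / 3) ^ 2 + (81 / 100 / A₁ - 1 / 3))⁻¹) ^ 2 ≤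
      layerInteraction lennardJones a D 1 1 - layerInteraction lennardJones (201 / 200 * a) D' 1 1 := by
  have ha : 0 < a ^ 2 := by linarith
  have hA0 : 0 < A₁ := by linarith
  have hane : a ≠ 0 := by rintro rfl; norm_num at ha
  have hs1 := ig_summable_layer hane D 1 (Or.inr rfl)
  have hs2 := ig_summable_layer (show 201 / 200 * a ≠ 0 from mul_ne_zero (by norm_num) hane) D' 1 (Or.inr rfl)
  rw [ig_LI_eq, ig_LI_eq, ← Summable.tsum_sub hs1 hs2]
  have hsite : ∀ p : ℤ × ℤ, igAdjL A₁ A₂ (igP 1 p) ≤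
      igE (a ^ 2 * igP 1 p + D ^ 2) - igE ((201 / 200 * a) ^ 2 * igP 1 p + D' ^ 2) := by
    intro p
    have e1 : a ^ 2 * igP 1 p + D ^ 2 = a ^ 2 * (igP 1 p - 1 / 3) + (a ^ 2 / 3 + D ^ 2) := by ring
    have e2 : (201 / 200 * a) ^ 2 * igP 1 p + D' ^ 2 =
        40401 / 40000 * a ^ 2 * (igP 1 p - 1 / 3) + (a ^ 2 / 3 + D ^ 2) := by rw [hD']; ring
    rw [e1, e2]
    exact ig_site_adjL hA₁ h1 h2 hb1 hb2 p
  have hC : (0 : ℝ) ≤ 401 / 40000 * A₂ / (2 * A₁ ^ 4) := by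
    have : 0 ≤ A₂ := by linarith
    positivity
  have hT : (0 : ℝ) < 81 / 100 / A₁ - 1 / 3 := by
    rw [sub_pos, lt_div_iff₀ hA0]; nlinarith
  obtain ⟨hns, hnle⟩ := ig_tail_inv_pow 1 (Or.inr rfl) hC hT (n := 2) hN (by norm_num)
  have e2 : ((2 : ℕ) : ℝ) = 2 := by norm_num
  rw [e2] at hnle
  refine ig_box_tail (hs1.sub hs2) hns (fun p _ => hsite p) (fun p _ => le_trans ?_ (hsite p)) hnle
  -- the majorant dominates `-igAdjL` everywhere
  unfold igAdjL
  split_ifs with h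
  · rw [neg_nonpos]; exact mul_nonneg hC (pow_nonneg (inv_nonneg.2 (by linarith [igP_nonneg 1 p])) _)
  · have h' : 1 ≤ igP 1 p := not_lt.1 h
    rw [neg_le_neg_iff]
    set x := igP 1 p - 1 / 3 with hx
    have hx0 : 0 ≤ x := by rw [hx]; linarith
    have hA₂ : 0 ≤ A₂ := by linarith
    have hsub1 : 1 - ((40401 / 40000 * A₂ * x + 2601 / 2500)⁻¹) ^ 3 ≤ 1 := by
      have : 0 ≤ ((40401 / 40000 * A₂ * x + 2601 / 2500)⁻¹) ^ 3 := by positivity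
      linarith
    have hmaj := ig_loss_majorant (show (0 : ℝ) ≤ 401 / 40000 * A₂ by positivity) hA0
      (by norm_num : (0 : ℝ) ≤ 81 / 100) (by nlinarith : 0 < A₁ * x + 81 / 100)
    have e3 : igP 1 p + (81 / 100 / A₁ - 1 / 3) = x + 81 / 100 / A₁ := by rw [hx]; ring
    rw [e3]
    calc 401 / 40000 * A₂ * x * (1 - ((40401 / 40000 * A₂ * x + 2601 / 2500)⁻¹) ^ 3) /
          (2 * (A₁ * x + 81 / 100) ^ 4)
        ≤ 401 / 40000 * A₂ * x * 1 / (2 * (A₁ * x + 81 / 100) ^ 4) := by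
          apply div_le_div_of_nonneg_right _ (by positivity)
          exact mul_le_mul_of_nonneg_left hsub1 (by positivity)
      _ = 401 / 40000 * A₂ * x / (2 * (A₁ * x + 81 / 100) ^ 4) := by ring
      _ ≤ _ := hmaj

/-- **A far layer under the expansion**: box certificate minus the tail of the horizontal-loss majorant.
[folklore] -/
theorem ig_layer_farL {a H H' A₁ A₂ h₁ h₂ h₁' β : ℝ} (δ : ℤ) (hδ : δ = 0 ∨ δ = 1) (hA₁ : 0 < A₁) (h1 : A₁ ≤ a ^ 2)
    (h2 : a ^ 2 ≤ A₂) (hh1 : h₁ ≤ H ^ 2) (hh2 : H ^ 2 ≤ h₂) (hh'1 : h₁' ≤ H' ^ 2) (hH' : H' ^ 2 ≤ H ^ 2)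
    (hβ : β ≤ H ^ 2 - H' ^ 2) (hβ0 : 0 ≤ β) (hone : 1 ≤ h₁') (hh' : h₁' ≤ h₁) {N : ℕ} (hN : 1 ≤ N) :
    ∑ p ∈ igBox N, igFarL A₁ A₂ h₁ h₂ h₁' β (igP δ p) -
        32 * ((N : ℝ) + 1) / (2 * (6 * N + 1)) * (401 / 40000 * A₂ / (2 * A₁ ^ 4)) *
          ((3 / 4 * ((N : ℝ) - 1 / 3) ^ 2 + h₁ / A₁)⁻¹) ^ 2 ≤
      layerInteraction lennardJones a H δ 1 - layerInteraction lennardJones (201 / 200 * a) H' δ 1 := by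
  have ha : 0 < a ^ 2 := by linarith
  have hane : a ≠ 0 := by rintro rfl; norm_num at ha
  have hs1 := ig_summable_layer hane H δ hδ
  have hs2 := ig_summable_layer (show 201 / 200 * a ≠ 0 from mul_ne_zero (by norm_num) hane) H' δ hδ
  rw [ig_LI_eq, ig_LI_eq, ← Summable.tsum_sub hs1 hs2]
  have hT : 0 < h₁ / A₁ := by have : 0 < h₁ := by linarith
                              positivity
  have hC : (0 : ℝ) ≤ 401 / 40000 * A₂ / (2 * A₁ ^ 4) := by
    have : 0 ≤ A₂ := by linarith
    positivity
  obtain ⟨hns, hnle⟩ := ig_tail_inv_pow δ hδ hC hT (n := 2) hN (by norm_num)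
  have hsite : ∀ p : ℤ × ℤ, igFarL A₁ A₂ h₁ h₂ h₁' β (igP δ p) ≤
      igE (a ^ 2 * igP δ p + H ^ 2) - igE ((201 / 200 * a) ^ 2 * igP δ p + H' ^ 2) := fun p => by
    rw [ig_lamL_sq]
    exact ig_site_farL hA₁ h1 h2 hh1 hh2 hh'1 hH' hβ hone hh' (igP_nonneg δ p)
  have e2 : ((2 : ℕ) : ℝ) = 2 := by norm_num
  rw [e2] at hnle
  refine ig_box_tail (hs1.sub hs2) hns (fun p _ => hsite p) (fun p _ => ?_) hnle
  exact (ig_farL_ge_neg hA₁ (h1.trans h2) hβ0 hone hh' (hh1.trans hh2) (igP_nonneg δ p)).trans (hsite p)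

/-- **The generic far-layer bound under the expansion**: the difference is at least
`-(401/40000)(A₂/(2A₁⁴))(9 T⁻³ + (32/7)(1/3 + T)⁻²)`, `T = h₁/A₁`. [folklore] -/
theorem ig_layer_genL {a H H' A₁ A₂ h₁ h₂ h₁' β : ℝ} (δ : ℤ) (hδ : δ = 0 ∨ δ = 1) (hA₁ : 0 < A₁) (h1 : A₁ ≤ a ^ 2)
    (h2 : a ^ 2 ≤ A₂) (hh1 : h₁ ≤ H ^ 2) (hh2 : H ^ 2 ≤ h₂) (hh'1 : h₁' ≤ H' ^ 2) (hH' : H' ^ 2 ≤ H ^ 2)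
    (hβ : β ≤ H ^ 2 - H' ^ 2) (hβ0 : 0 ≤ β) (hone : 1 ≤ h₁') (hh' : h₁' ≤ h₁) :
    -(401 / 40000 * A₂ / (2 * A₁ ^ 4) * (9 * ((h₁ / A₁)⁻¹) ^ 3 + 32 / 7 * ((1 / 3 + h₁ / A₁)⁻¹) ^ 2)) ≤
      layerInteraction lennardJones a H δ 1 - layerInteraction lennardJones (201 / 200 * a) H' δ 1 := by
  have ha : 0 < a ^ 2 := by linarith
  have hane : a ≠ 0 := by rintro rfl; norm_num at ha
  have hs1 := ig_summable_layer hane H δ hδ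
  have hs2 := ig_summable_layer (show 201 / 200 * a ≠ 0 from mul_ne_zero (by norm_num) hane) H' δ hδ
  rw [ig_LI_eq, ig_LI_eq, ← Summable.tsum_sub hs1 hs2]
  have hT : 0 < h₁ / A₁ := by have : 0 < h₁ := by linarith
                              positivity
  obtain ⟨hns, hnle⟩ := ig_tsum_inv3_le δ hδ hT
  have hC : (0 : ℝ) ≤ 401 / 40000 * A₂ / (2 * A₁ ^ 4) := by
    have : 0 ≤ A₂ := by linarith
    positivity
  have hsite : ∀ p : ℤ × ℤ, -(401 / 40000 * A₂ / (2 * A₁ ^ 4) * ((igP δ p + h₁ / A₁)⁻¹) ^ 3) ≤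
      igE (a ^ 2 * igP δ p + H ^ 2) - igE ((201 / 200 * a) ^ 2 * igP δ p + H' ^ 2) := fun p => by
    rw [ig_lamL_sq]
    exact (ig_farL_ge_neg hA₁ (h1.trans h2) hβ0 hone hh' (hh1.trans hh2) (igP_nonneg δ p)).trans
      (ig_site_farL hA₁ h1 h2 hh1 hh2 hh'1 hH' hβ hone hh' (igP_nonneg δ p))
  have h3 := Summable.tsum_le_tsum hsite (hns.mul_left _).neg (hs1.sub hs2)
  rw [tsum_neg, tsum_mul_left] at h3
  have h4 := mul_le_mul_of_nonneg_left hnle hC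
  linarith

end Summit.AtomisticToContinuum.Crystallization.Theorems.CleanHull

end
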